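import Summits.BirchSwinnertonDyer.BirchSwinnertonDyer.Theorems.EisensteinPrimesMazurMCOnCellBTwistbackTwistDoorParity
import Summits.BirchSwinnertonDyer.BirchSwinnertonDyer.Theorems.EisensteinPrimesLineWeilRelation
import Summits.BirchSwinnertonDyer.BirchSwinnertonDyer.Theorems.EisensteinPrimesLinePsiAtMultiplicativePrime
import Summits.BirchSwinnertonDyer.BirchSwinnertonDyer.Theorems.EisensteinPrimesLinePhiAtMultiplicativePrime
import Literature.NumberTheory.LFunctions.PrimitiveQuadraticCharacterKroneckerEven
import HarnessLib

/-!
# Crux 3 `MazurMCOnCellB` (stmt-BirchSwinnertonDyer-19033), line `twistback` v4 — the TWIST DOOR FROM THE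
# `W`-SIDE, part 6 (FINAL FORM at `p = 3`): stub 6's partner clause at a non-split X2b pair `(W, 3)` from the
# `3`-line datum of `W`, its bad places and the local balance `1` — the Weil relation, the conductor support
# and `ψ(3) = a_3` DISCHARGED by LEAD g11's p652931 and width seat w7's p649032 / p650111

Width seat bsd-line-x2-p1-w3 (gen 9), cell `bsd-eis` (run/shared/lean/pub/bsd-eis/), 2026-08-28. HONEST FRAMING:
THEOREMS ONLY (no `def`, no named fact introduced, no `sorry`); a two-theorem composition of part 5 with
`EisensteinPrimesLineWeilRelation.weilRelation_of_line` / `level_dvd_of_line` (LEAD g11) and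
`EisensteinPrimesLinePsiAtMultiplicativePrime.psi_natCast_ne_one_of_not_split` /
`EisensteinPrimesLinePhiAtMultiplicativePrime.phi_natCast_eq_neg_one_of_not_split_of_lineUnramifiedAt` (w7);
`--supports` stmt-BirchSwinnertonDyer-19033; closes no stub by itself; CONDITIONAL exactly as w5's p652304
(`PublishedInputs` = stmt-…-19037, Disegni 2020 Thm. 4(1), Greenberg–Vatsal Thm. (3.11), Dokchitser–Dokchitser Thm. 1.4 —
PUB; Keller–Yin 2024 Thm. E — UNREFEREED PREPRINT; Nakagawa–Horie 1988 + Taya 2000 — PUB named fact p650412); no summit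
statement, no Mazur main conjecture and no BSD is proved for any curve; 0 cells / labels / tiers move.

* `upperPartner_at_three_of_oddRamifiedLine_of_thmE` — FIRST X2b SHAPE. `W`-side inputs ONLY: `X2.CellB W 3`, `3`
  non-split; a rational `3`-line `Φ₀` RAMIFIED at `3` and ODD with PRIMITIVE characters `φ` mod `m` (`3 ∣ m`) and `ψ`
  mod `d` (`3 ∤ d`) in the door binder shapes; `d` (the even character's conductor) a positive fundamental
  discriminant; a finite set of places `S₀ ∌ (3)` with `ℓ_v ∣ N_W` on `S₀` and `W` good off `S₀ ∪ {3}`; the balance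
  `1 + Σ_{S₀} δ_W = Σ_{S₀} s([φ=ℓ̄]+[ψ=ℓ̄])` («c(E) = 1»). Output: the partner clause of `stub_upperPartner` AT `(W, 3)`
  (verbatim shape of p645525 §3).
* `upperPartner_at_three_of_evenUnramifiedLine_of_thmE` — SECOND X2b SHAPE (line UNRAMIFIED-EVEN, `3 ∤ m`, `3 ∣ d`,
  `m` a positive fundamental discriminant), same output.

So on the twistback road (d′) the class-wide remainder of stub 6 on the sub-row «non-split, balance 1» at `p = 3` is:
(i) the named facts above (KY Thm. D/E PRE), (ii) the LINE DATUM of `W` with its characters (per curve: the tree's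
certificate files; class-wide: `exists_character_of_natCard_eq` + `exists_isPrimitive_dirichletCharacter_of_isOpen_ker`
give them, the binder shapes are what the doors fix), (iii) «c(E) = 1» itself (lam-a g16: 30/44 A10 non-split cells).

References: [GreenbergVatsal2000] Thm. (1.3), §2 pp. 14–15, 28, §3 Thm. (3.11), (28), p. 42; [Disegni2020] Thm. 4;
[Wuthrich2014] Thm. 16; [DokchitserDokchitserAnnals2010] Thm. 1.4; [NakagawaHorie1988] Thm. 1; [KellerYin2024] Thm. E
(PRE); [Washington1997] Thm. 4.17; [SilvermanATAEC1994] Thm. V.3.1, V.5.3, Cor. V.5.4.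
-/

set_option autoImplicit false

-- `Summit.BirchSwinnertonDyer.BirchSwinnertonDyer.…`: the summit and its single sub-problem share a name.
set_option linter.dupNamespace false

noncomputable section

open scoped Classical NumberTheorySymbols

open WeierstrassCurve NumberField IsDedekindDomain Field DirichletCharacter
  Literature.NumberTheory.EllipticCurves Literature.NumberTheory.GaloisRepresentations
  Literature.NumberTheory.EllipticCurves.GreenbergVatsal2000
  Literature.NumberTheory.EllipticCurves.Rank1Residual Literature.NumberTheory.EllipticCurves.Rank1Residual.Typed
  Literature.NumberTheory.EllipticCurves.Disegni2020 Literature.NumberTheory.EllipticCurves.KellerYin2024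
  Literature.NumberTheory.QuadraticFields Literature.NumberTheory.QuadraticFields.Quadratic
  Summit.BirchSwinnertonDyer.Rank1Residual Summit.BirchSwinnertonDyer.Rank1Residual.X2
  Summit.BirchSwinnertonDyer.BirchSwinnertonDyer.Theses
  Summit.BirchSwinnertonDyer.BirchSwinnertonDyer.Theorems

namespace Summit.BirchSwinnertonDyer.BirchSwinnertonDyer.Theorems.EisensteinPrimesMazurMCOnCellBTwistbackTwistDoorFinal

/-- **Stub 6's partner clause AT a NON-split X2b pair `(W, 3)` from the `3`-LINE DATUM of `W`, its bad places and the
balance `1` — FIRST X2b SHAPE (line RAMIFIED at `3`, ODD).** Part 5's `upperPartner_at_three_of_ramifiedOddLine_of_thmE`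
with its last three character hypotheses DISCHARGED: the Weil relation `φ(a)a⁻¹ = ψ⁻¹(a)` by
`EisensteinPrimesLineWeilRelation.weilRelation_of_line`, `m ∣ 3d` by `…level_dvd_of_line` (LEAD g11, p652931), and
`ψ(3) ≠ 1` by `EisensteinPrimesLinePsiAtMultiplicativePrime.psi_natCast_ne_one_of_not_split` (w7, p649032: `ψ(3) = a_3
= −1` at the non-split prime for the RAMIFIED line's quotient character). Remaining inputs: `X2.CellB W 3`, `3` non-split,
the line datum (`Φ₀`, primitive `φ` mod `m ∋ 3`, `ψ` mod `d ∌ 3`, binder shapes `hφ0`/`hψ0`), `d` a positive fundamental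
discriminant, `S₀` (`ℓ_v ∣ N_W`, `W` good off `S₀ ∪ {3}`), the balance `1`. CONDITIONAL on the named facts of p652304;
BSD / Mazur's MC proved for no curve. [claim: KellerYin2024, status: under-review] [cite: NakagawaHorie1988, Thm. 1]
[cite: GreenbergVatsal2000, Thm. (1.3), §2 p. 28, §3 Thm. (3.11), (28), p. 42] [cite: Disegni2020, Thm. 4 (§3.2)]
[cite: Wuthrich2014, Thm. 16 (p. 397)] [cite: DokchitserDokchitserAnnals2010, Thm. 1.4] [cite: SilvermanATAEC1994, Thm. V.5.3, Cor. V.5.4] -/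
theorem upperPartner_at_three_of_oddRamifiedLine_of_thmE
    (hP : EisensteinPrimes.PublishedInputs)
    (hDis : padicBSD_rankOne_nonsplitMult) (h311 : thm311_hasUnitContent_iff_and_order_eq_of_lineRamifiedEven)
    (hDD : ∀ (V : WeierstrassCurve ℚ) [V.IsElliptic] (ℓ : ℕ) [Fact ℓ.Prime], selmerCorank_mod_two_eq V ℓ)
    (hKY : thmE_pConverse_semistable_OPEN)
    (hNH : Literature.NumberTheory.QuadraticFields.nakagawaHorie_taya_exists_imaginary_h3_eq_one)
    (W : WeierstrassCurve ℚ) [W.IsElliptic] [W.IsGloballyMinimal]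
    (hc : X2.CellB W 3) (hns : ¬ W.HasSplitMultiplicativeReductionAtPrime 3)
    {Φ₀ : AddSubgroup (geomTorsion W ((3 : ℕ) : ℤ))} (hΦ : IsRationalLine W 3 Φ₀)
    (hram : ¬ LineUnramifiedAt W 3 Φ₀) (hoddL : LineOdd W 3 Φ₀)
    {m : ℕ} [NeZero m] (φ : DirichletCharacter (ZMod 3) m) {d : ℕ} [NeZero d]
    (ψ : DirichletCharacter (ZMod 3) d) (hφ : φ.IsPrimitive) (hψ : ψ.IsPrimitive) (h3m : 3 ∣ m)
    (h3d : ¬ 3 ∣ d)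
    (hDf : ((d : ℤ) % 4 = 1 ∧ Squarefree (d : ℤ) ∧ (d : ℤ) ≠ 1) ∨
      (4 ∣ (d : ℤ) ∧ ((d : ℤ) / 4 % 4 = 2 ∨ (d : ℤ) / 4 % 4 = 3) ∧ Squarefree ((d : ℤ) / 4)))
    (hφ0 : ∀ (σ : absoluteGaloisGroup ℚ), ∀ P ∈ Φ₀,
      σ • P = (φ ((modNCyclotomicCharacter ℚ m σ : (ZMod m)ˣ) : ZMod m)).val • P)
    (hψ0 : ∀ (σ : absoluteGaloisGroup ℚ) (P : geomTorsion W ((3 : ℕ) : ℤ)),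
      σ • P - (ψ ((modNCyclotomicCharacter ℚ d σ : (ZMod d)ˣ) : ZMod d)).val • P ∈ Φ₀)
    (S₀ : Finset (HeightOneSpectrum (𝓞 ℚ))) (hS₀p : ∀ v ∈ S₀, ((3 : ℕ) : 𝓞 ℚ) ∉ v.asIdeal)
    (hS₀N : ∀ v ∈ S₀, Rat.HeightOneSpectrum.natGenerator v ∣ W.conductorNorm ℤ)
    (hS : ∀ v : HeightOneSpectrum (𝓞 ℚ), v ∉ S₀ → ((3 : ℕ) : 𝓞 ℚ) ∉ v.asIdeal → W.HasGoodReductionAt v)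
    (hbal : 1 + ∑ v ∈ S₀, delta W 3 v =
      ∑ v ∈ S₀, ((if φ (Rat.HeightOneSpectrum.natGenerator v : ZMod m) =
            (Rat.HeightOneSpectrum.natGenerator v : ZMod 3)
          then sFactor 3 (Rat.HeightOneSpectrum.natGenerator v) else 0) +
        (if ψ (Rat.HeightOneSpectrum.natGenerator v : ZMod d) =
            (Rat.HeightOneSpectrum.natGenerator v : ZMod 3)
          then sFactor 3 (Rat.HeightOneSpectrum.natGenerator v) else 0))) :
    ∃ (K : Type) (_ : Field K) (_ : NumberField K), IsImaginaryQuadratic K ∧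
      SatisfiesHeegnerHypothesis (W.conductorNorm ℤ) K ∧ SatisfiesHeegnerHypothesis 3 K ∧
      Odd (NumberField.discr K) ∧ NumberField.discr K < -4 ∧
      (W.quadraticTwist (NumberField.discr K : ℚ)).analyticRank = 1 ∧
      ∀ (Wd : WeierstrassCurve ℚ) [Wd.IsElliptic] [Wd.IsGloballyMinimal],
        (∃ C : VariableChange ℚ, C • Wd = W.quadraticTwist (NumberField.discr K : ℚ)) →
        MissingUpperBoundAt Wd 3 := by
  -- the Weil relation and the conductor support (LEAD g11, p652931); `ψ(3) = a_3 = −1 ≠ 1` (w7, p649032)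
  have hφψ := EisensteinPrimesLineWeilRelation.weilRelation_of_line hΦ hφ hψ hφ0 hψ0
  have hm3d : m ∣ 3 * d := by
    rw [mul_comm]; exact (EisensteinPrimesLineWeilRelation.level_dvd_of_line hΦ hφ hψ hφ0 hψ0).1
  have hψ3 : ψ (3 : ZMod d) ≠ 1 := by
    have h := EisensteinPrimesLinePsiAtMultiplicativePrime.psi_natCast_ne_one_of_not_split (by decide) hc.2.1.2.2
      hns hΦ hram ψ h3d hψ0
    rwa [Nat.cast_ofNat] at h
  exact EisensteinPrimesMazurMCOnCellBTwistbackTwistDoorParity.upperPartner_at_three_of_ramifiedOddLine_of_thmE hP hDis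
    h311 hDD hKY hNH W hc hns hΦ hram hoddL φ ψ hφ hψ h3m h3d hm3d hDf hφ0 hψ0 S₀ hS₀p hS₀N hS hψ3 hφψ hbal

/-- **Stub 6's partner clause AT a NON-split X2b pair `(W, 3)` from the `3`-LINE DATUM of `W` — SECOND X2b SHAPE
(line UNRAMIFIED at `3`, EVEN).** Part 5's `upperPartner_at_three_of_unramifiedEvenLine_of_thmE` with the Weil relation
and `d ∣ 3m` from p652931 and `φ(3) = −1 ≠ 1` from
`EisensteinPrimesLinePhiAtMultiplicativePrime.phi_natCast_eq_neg_one_of_not_split_of_lineUnramifiedAt` (w7, p650111).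
Remaining inputs: `X2.CellB W 3`, `3` non-split, the line datum (primitive `φ` mod `m ∌ 3`, `ψ` mod `d ∋ 3`), `m` a
positive fundamental discriminant, `S₀`, the balance `1`. Same honest framing.
[claim: KellerYin2024, status: under-review] [cite: NakagawaHorie1988, Thm. 1]
[cite: GreenbergVatsal2000, Thm. (1.3), §2 p. 28, §3 Thm. (3.11), (28), p. 42] [cite: Disegni2020, Thm. 4 (§3.2)]
[cite: Wuthrich2014, Thm. 16 (p. 397)] [cite: DokchitserDokchitserAnnals2010, Thm. 1.4] [cite: SilvermanATAEC1994, Thm. V.3.1, V.5.3] -/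
theorem upperPartner_at_three_of_evenUnramifiedLine_of_thmE
    (hP : EisensteinPrimes.PublishedInputs)
    (hDis : padicBSD_rankOne_nonsplitMult) (h311 : thm311_hasUnitContent_iff_and_order_eq_of_lineRamifiedEven)
    (hDD : ∀ (V : WeierstrassCurve ℚ) [V.IsElliptic] (ℓ : ℕ) [Fact ℓ.Prime], selmerCorank_mod_two_eq V ℓ)
    (hKY : thmE_pConverse_semistable_OPEN)
    (hNH : Literature.NumberTheory.QuadraticFields.nakagawaHorie_taya_exists_imaginary_h3_eq_one)
    (W : WeierstrassCurve ℚ) [W.IsElliptic] [W.IsGloballyMinimal]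
    (hc : X2.CellB W 3) (hns : ¬ W.HasSplitMultiplicativeReductionAtPrime 3)
    {Φ₀ : AddSubgroup (geomTorsion W ((3 : ℕ) : ℤ))} (hΦ : IsRationalLine W 3 Φ₀)
    (hunr : LineUnramifiedAt W 3 Φ₀) (hevenL : LineEven W 3 Φ₀)
    {m : ℕ} [NeZero m] (φ : DirichletCharacter (ZMod 3) m) {d : ℕ} [NeZero d]
    (ψ : DirichletCharacter (ZMod 3) d) (hφ : φ.IsPrimitive) (hψ : ψ.IsPrimitive) (h3m : ¬ 3 ∣ m)
    (h3d : 3 ∣ d)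
    (hDf : ((m : ℤ) % 4 = 1 ∧ Squarefree (m : ℤ) ∧ (m : ℤ) ≠ 1) ∨
      (4 ∣ (m : ℤ) ∧ ((m : ℤ) / 4 % 4 = 2 ∨ (m : ℤ) / 4 % 4 = 3) ∧ Squarefree ((m : ℤ) / 4)))
    (hφ0 : ∀ (σ : absoluteGaloisGroup ℚ), ∀ P ∈ Φ₀,
      σ • P = (φ ((modNCyclotomicCharacter ℚ m σ : (ZMod m)ˣ) : ZMod m)).val • P)
    (hψ0 : ∀ (σ : absoluteGaloisGroup ℚ) (P : geomTorsion W ((3 : ℕ) : ℤ)),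
      σ • P - (ψ ((modNCyclotomicCharacter ℚ d σ : (ZMod d)ˣ) : ZMod d)).val • P ∈ Φ₀)
    (S₀ : Finset (HeightOneSpectrum (𝓞 ℚ))) (hS₀p : ∀ v ∈ S₀, ((3 : ℕ) : 𝓞 ℚ) ∉ v.asIdeal)
    (hS₀N : ∀ v ∈ S₀, Rat.HeightOneSpectrum.natGenerator v ∣ W.conductorNorm ℤ)
    (hS : ∀ v : HeightOneSpectrum (𝓞 ℚ), v ∉ S₀ → ((3 : ℕ) : 𝓞 ℚ) ∉ v.asIdeal → W.HasGoodReductionAt v)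
    (hbal : 1 + ∑ v ∈ S₀, delta W 3 v =
      ∑ v ∈ S₀, ((if φ (Rat.HeightOneSpectrum.natGenerator v : ZMod m) =
            (Rat.HeightOneSpectrum.natGenerator v : ZMod 3)
          then sFactor 3 (Rat.HeightOneSpectrum.natGenerator v) else 0) +
        (if ψ (Rat.HeightOneSpectrum.natGenerator v : ZMod d) =
            (Rat.HeightOneSpectrum.natGenerator v : ZMod 3)
          then sFactor 3 (Rat.HeightOneSpectrum.natGenerator v) else 0))) :
    ∃ (K : Type) (_ : Field K) (_ : NumberField K), IsImaginaryQuadratic K ∧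
      SatisfiesHeegnerHypothesis (W.conductorNorm ℤ) K ∧ SatisfiesHeegnerHypothesis 3 K ∧
      Odd (NumberField.discr K) ∧ NumberField.discr K < -4 ∧
      (W.quadraticTwist (NumberField.discr K : ℚ)).analyticRank = 1 ∧
      ∀ (Wd : WeierstrassCurve ℚ) [Wd.IsElliptic] [Wd.IsGloballyMinimal],
        (∃ C : VariableChange ℚ, C • Wd = W.quadraticTwist (NumberField.discr K : ℚ)) →
        MissingUpperBoundAt Wd 3 := by
  have hφψ := EisensteinPrimesLineWeilRelation.weilRelation_of_line hΦ hφ hψ hφ0 hψ0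
  have hd3m : d ∣ 3 * m := by
    rw [mul_comm]; exact (EisensteinPrimesLineWeilRelation.level_dvd_of_line hΦ hφ hψ hφ0 hψ0).2
  -- `φ(3) = a_3 = −1 ≠ 1` for the UNRAMIFIED line at the non-split prime (w7, p650111)
  have hφ3 : φ (3 : ZMod m) ≠ 1 := by
    have h := EisensteinPrimesLinePhiAtMultiplicativePrime.phi_natCast_eq_neg_one_of_not_split_of_lineUnramifiedAt
      (by decide) hc.2.1.2.2 hns hΦ hunr φ h3m hφ0
    rw [Nat.cast_ofNat] at h
    rw [h]
    decide
  exact EisensteinPrimesMazurMCOnCellBTwistbackTwistDoorParity.upperPartner_at_three_of_unramifiedEvenLine_of_thmE hP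
    hDis h311 hDD hKY hNH W hc hns hΦ hunr hevenL φ ψ hφ hψ h3m h3d hd3m hDf hφ0 hψ0 S₀ hS₀p hS₀N hS hφ3 hφψ hbal

/-! ## Appended: the fundamental-discriminant hypothesis DISCHARGED (`1 < d` resp. `1 < m` suffices) -/

/-- **The conductor of an EVEN primitive quadratic-valued `𝔽_p`-character (`p ≠ 2`, conductor `> 1`) is a positive
fundamental discriminant** — in the spelled-out shape used by w6's field supply (`exists_admissibleField_…`) and w5's
p652304: transfer to the complex avatar with the same conductor and parity (w3 g7,
`…TwistbackPartnerClassNumberLift.exists_complex_avatar`) and apply the tree's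
`PrimitiveQuadratic.isFundamentalDiscriminant_of_even` (Montgomery–Vaughan Thm. 9.13).
[cite: MontgomeryVaughan2007, §9.3 Thm. 9.13] -/
theorem isFundamentalDiscriminant_of_even_primitive_zmod {p d : ℕ} [Fact p.Prime] [NeZero d] (hp2 : p ≠ 2)
    (ψ : DirichletCharacter (ZMod p) d) (hψ : ψ.IsPrimitive) (hψq : ψ.IsQuadratic) (hψe : ψ.Even) (hd1 : 1 < d) :
    ((d : ℤ) % 4 = 1 ∧ Squarefree (d : ℤ) ∧ (d : ℤ) ≠ 1) ∨
      (4 ∣ (d : ℤ) ∧ ((d : ℤ) / 4 % 4 = 2 ∨ (d : ℤ) / 4 % 4 = 3) ∧ Squarefree ((d : ℤ) / 4)) := by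
  obtain ⟨χ, F, hχq, -, -, hcond, -, heven⟩ :=
    EisensteinPrimesMazurMCOnCellBTwistbackPartnerClassNumberLift.exists_complex_avatar p hp2 ψ hψq
  have hχprim : χ.IsPrimitive := by
    rw [DirichletCharacter.isPrimitive_def, hcond]
    exact hψ
  exact Literature.NumberTheory.LFunctions.PrimitiveQuadratic.isFundamentalDiscriminant_of_even hχprim hχq (heven hψe)
    hd1

/-- **FIRST SHAPE, final form with `1 < d` in place of «`d` is a fundamental discriminant»** (`ψ` non-trivial suffices:
`ψ` is even — LEAD g11's `even_quot_of_lineOdd` —, primitive and quadratic-valued over `𝔽₃`). `W`-side inputs: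
`X2.CellB W 3`, `3` non-split, the ramified-odd `3`-line datum with primitive `φ` mod `m ∋ 3`, `ψ` mod `d ∌ 3`, `d > 1`,
`S₀`, the balance `1`. CONDITIONAL as the un-primed theorem; no curve's BSD / MC is proved.
[claim: KellerYin2024, status: under-review] [cite: NakagawaHorie1988, Thm. 1] [cite: MontgomeryVaughan2007, §9.3 Thm. 9.13]
[cite: GreenbergVatsal2000, Thm. (1.3), §2 p. 28, §3 Thm. (3.11), (28)] [cite: Disegni2020, Thm. 4 (§3.2)]
[cite: Wuthrich2014, Thm. 16 (p. 397)] [cite: DokchitserDokchitserAnnals2010, Thm. 1.4] -/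
theorem upperPartner_at_three_of_oddRamifiedLine_of_thmE'
    (hP : EisensteinPrimes.PublishedInputs)
    (hDis : padicBSD_rankOne_nonsplitMult) (h311 : thm311_hasUnitContent_iff_and_order_eq_of_lineRamifiedEven)
    (hDD : ∀ (V : WeierstrassCurve ℚ) [V.IsElliptic] (ℓ : ℕ) [Fact ℓ.Prime], selmerCorank_mod_two_eq V ℓ)
    (hKY : thmE_pConverse_semistable_OPEN)
    (hNH : Literature.NumberTheory.QuadraticFields.nakagawaHorie_taya_exists_imaginary_h3_eq_one)
    (W : WeierstrassCurve ℚ) [W.IsElliptic] [W.IsGloballyMinimal]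
    (hc : X2.CellB W 3) (hns : ¬ W.HasSplitMultiplicativeReductionAtPrime 3)
    {Φ₀ : AddSubgroup (geomTorsion W ((3 : ℕ) : ℤ))} (hΦ : IsRationalLine W 3 Φ₀)
    (hram : ¬ LineUnramifiedAt W 3 Φ₀) (hoddL : LineOdd W 3 Φ₀)
    {m : ℕ} [NeZero m] (φ : DirichletCharacter (ZMod 3) m) {d : ℕ} [NeZero d]
    (ψ : DirichletCharacter (ZMod 3) d) (hφ : φ.IsPrimitive) (hψ : ψ.IsPrimitive) (h3m : 3 ∣ m)
    (h3d : ¬ 3 ∣ d)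
    (hd1 : 1 < d)
    (hφ0 : ∀ (σ : absoluteGaloisGroup ℚ), ∀ P ∈ Φ₀,
      σ • P = (φ ((modNCyclotomicCharacter ℚ m σ : (ZMod m)ˣ) : ZMod m)).val • P)
    (hψ0 : ∀ (σ : absoluteGaloisGroup ℚ) (P : geomTorsion W ((3 : ℕ) : ℤ)),
      σ • P - (ψ ((modNCyclotomicCharacter ℚ d σ : (ZMod d)ˣ) : ZMod d)).val • P ∈ Φ₀)
    (S₀ : Finset (HeightOneSpectrum (𝓞 ℚ))) (hS₀p : ∀ v ∈ S₀, ((3 : ℕ) : 𝓞 ℚ) ∉ v.asIdeal)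
    (hS₀N : ∀ v ∈ S₀, Rat.HeightOneSpectrum.natGenerator v ∣ W.conductorNorm ℤ)
    (hS : ∀ v : HeightOneSpectrum (𝓞 ℚ), v ∉ S₀ → ((3 : ℕ) : 𝓞 ℚ) ∉ v.asIdeal → W.HasGoodReductionAt v)
    (hbal : 1 + ∑ v ∈ S₀, delta W 3 v =
      ∑ v ∈ S₀, ((if φ (Rat.HeightOneSpectrum.natGenerator v : ZMod m) =
            (Rat.HeightOneSpectrum.natGenerator v : ZMod 3)
          then sFactor 3 (Rat.HeightOneSpectrum.natGenerator v) else 0) +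
        (if ψ (Rat.HeightOneSpectrum.natGenerator v : ZMod d) =
            (Rat.HeightOneSpectrum.natGenerator v : ZMod 3)
          then sFactor 3 (Rat.HeightOneSpectrum.natGenerator v) else 0))) :
    ∃ (K : Type) (_ : Field K) (_ : NumberField K), IsImaginaryQuadratic K ∧
      SatisfiesHeegnerHypothesis (W.conductorNorm ℤ) K ∧ SatisfiesHeegnerHypothesis 3 K ∧
      Odd (NumberField.discr K) ∧ NumberField.discr K < -4 ∧
      (W.quadraticTwist (NumberField.discr K : ℚ)).analyticRank = 1 ∧
      ∀ (Wd : WeierstrassCurve ℚ) [Wd.IsElliptic] [Wd.IsGloballyMinimal],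
        (∃ C : VariableChange ℚ, C • Wd = W.quadraticTwist (NumberField.discr K : ℚ)) →
        MissingUpperBoundAt Wd 3 := by
  -- `d` is a positive fundamental discriminant: `ψ` is primitive, EVEN (the line is odd) and quadratic-valued over `𝔽₃`
  have hDf := isFundamentalDiscriminant_of_even_primitive_zmod (by decide) ψ hψ
    (EisensteinPrimesMazurMCOnCellBTwistbackPartnerClassNumberLift.isQuadratic_of_zmod_three ψ)
    (EisensteinPrimesLineWeilRelation.even_quot_of_lineOdd hΦ hoddL hφ0 hψ0) hd1
  exact upperPartner_at_three_of_oddRamifiedLine_of_thmE hP hDis h311 hDD hKY hNH W hc hns hΦ hram hoddL φ ψ hφ hψ h3m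
    h3d hDf hφ0 hψ0 S₀ hS₀p hS₀N hS hbal

/-- **SECOND SHAPE, final form with `1 < m` in place of «`m` is a fundamental discriminant»** (`φ` is even — part 5's
`even_of_lineEven` —, primitive and quadratic-valued over `𝔽₃`). Same honest framing.
[claim: KellerYin2024, status: under-review] [cite: NakagawaHorie1988, Thm. 1] [cite: MontgomeryVaughan2007, §9.3 Thm. 9.13]
[cite: GreenbergVatsal2000, Thm. (1.3), §2 p. 28, §3 Thm. (3.11), (28)] [cite: Disegni2020, Thm. 4 (§3.2)]
[cite: Wuthrich2014, Thm. 16 (p. 397)] [cite: SilvermanATAEC1994, Thm. V.3.1, V.5.3] -/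
theorem upperPartner_at_three_of_evenUnramifiedLine_of_thmE'
    (hP : EisensteinPrimes.PublishedInputs)
    (hDis : padicBSD_rankOne_nonsplitMult) (h311 : thm311_hasUnitContent_iff_and_order_eq_of_lineRamifiedEven)
    (hDD : ∀ (V : WeierstrassCurve ℚ) [V.IsElliptic] (ℓ : ℕ) [Fact ℓ.Prime], selmerCorank_mod_two_eq V ℓ)
    (hKY : thmE_pConverse_semistable_OPEN)
    (hNH : Literature.NumberTheory.QuadraticFields.nakagawaHorie_taya_exists_imaginary_h3_eq_one)
    (W : WeierstrassCurve ℚ) [W.IsElliptic] [W.IsGloballyMinimal]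
    (hc : X2.CellB W 3) (hns : ¬ W.HasSplitMultiplicativeReductionAtPrime 3)
    {Φ₀ : AddSubgroup (geomTorsion W ((3 : ℕ) : ℤ))} (hΦ : IsRationalLine W 3 Φ₀)
    (hunr : LineUnramifiedAt W 3 Φ₀) (hevenL : LineEven W 3 Φ₀)
    {m : ℕ} [NeZero m] (φ : DirichletCharacter (ZMod 3) m) {d : ℕ} [NeZero d]
    (ψ : DirichletCharacter (ZMod 3) d) (hφ : φ.IsPrimitive) (hψ : ψ.IsPrimitive) (h3m : ¬ 3 ∣ m)
    (h3d : 3 ∣ d)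
    (hm1 : 1 < m)
    (hφ0 : ∀ (σ : absoluteGaloisGroup ℚ), ∀ P ∈ Φ₀,
      σ • P = (φ ((modNCyclotomicCharacter ℚ m σ : (ZMod m)ˣ) : ZMod m)).val • P)
    (hψ0 : ∀ (σ : absoluteGaloisGroup ℚ) (P : geomTorsion W ((3 : ℕ) : ℤ)),
      σ • P - (ψ ((modNCyclotomicCharacter ℚ d σ : (ZMod d)ˣ) : ZMod d)).val • P ∈ Φ₀)
    (S₀ : Finset (HeightOneSpectrum (𝓞 ℚ))) (hS₀p : ∀ v ∈ S₀, ((3 : ℕ) : 𝓞 ℚ) ∉ v.asIdeal)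
    (hS₀N : ∀ v ∈ S₀, Rat.HeightOneSpectrum.natGenerator v ∣ W.conductorNorm ℤ)
    (hS : ∀ v : HeightOneSpectrum (𝓞 ℚ), v ∉ S₀ → ((3 : ℕ) : 𝓞 ℚ) ∉ v.asIdeal → W.HasGoodReductionAt v)
    (hbal : 1 + ∑ v ∈ S₀, delta W 3 v =
      ∑ v ∈ S₀, ((if φ (Rat.HeightOneSpectrum.natGenerator v : ZMod m) =
            (Rat.HeightOneSpectrum.natGenerator v : ZMod 3)
          then sFactor 3 (Rat.HeightOneSpectrum.natGenerator v) else 0) +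
        (if ψ (Rat.HeightOneSpectrum.natGenerator v : ZMod d) =
            (Rat.HeightOneSpectrum.natGenerator v : ZMod 3)
          then sFactor 3 (Rat.HeightOneSpectrum.natGenerator v) else 0))) :
    ∃ (K : Type) (_ : Field K) (_ : NumberField K), IsImaginaryQuadratic K ∧
      SatisfiesHeegnerHypothesis (W.conductorNorm ℤ) K ∧ SatisfiesHeegnerHypothesis 3 K ∧
      Odd (NumberField.discr K) ∧ NumberField.discr K < -4 ∧
      (W.quadraticTwist (NumberField.discr K : ℚ)).analyticRank = 1 ∧
      ∀ (Wd : WeierstrassCurve ℚ) [Wd.IsElliptic] [Wd.IsGloballyMinimal],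
        (∃ C : VariableChange ℚ, C • Wd = W.quadraticTwist (NumberField.discr K : ℚ)) →
        MissingUpperBoundAt Wd 3 := by
  have hDf := isFundamentalDiscriminant_of_even_primitive_zmod (by decide) φ hφ
    (EisensteinPrimesMazurMCOnCellBTwistbackPartnerClassNumberLift.isQuadratic_of_zmod_three φ)
    (EisensteinPrimesMazurMCOnCellBTwistbackTwistDoorParity.even_of_lineEven hΦ hevenL φ hφ0) hm1
  exact upperPartner_at_three_of_evenUnramifiedLine_of_thmE hP hDis h311 hDD hKY hNH W hc hns hΦ hunr hevenL φ ψ hφ hψ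
    h3m h3d hDf hφ0 hψ0 S₀ hS₀p hS₀N hS hbal

end Summit.BirchSwinnertonDyer.BirchSwinnertonDyer.Theorems.EisensteinPrimesMazurMCOnCellBTwistbackTwistDoorFinal

end
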